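import Summits.ABC.StewartYu.PadicTwoPack
import HarnessLib

/-!
# The Waldschmidt-shape `2`-adic engine with its constant WRITTEN OUT (papers lane ABC-P1, writer seat; theorems only)

`Summits/ABC/ABC/Theorems/AbcExplicitW80EngineTwo.lean`.  The cell's `2`-adic engine
`Summit.ABC.StewartYu.TwoSetup.engineTwoW80` (`PadicTwoPack.lean`) is the `∃ (C) (c₁)`-packaging, by
`engineTwoW80_of_coreBound` (`PadicTwoEngine.lean`), of the landed core bound `twoCoreBound_holds :
TwoCoreBound (fun m => 2 * PadicW80Par.Cw m)`; the witnesses are `3·C m = 6·Cw m` (`m ≥ 1`) and `c₁ = 3·2^70`, not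
visible in the `∃`-statement.  This file re-runs the reduction `engineTwoW80_of_coreBound` VERBATIM with the
existential opened:

* `TwoSetup.engineTwoW80_of_coreBound_explicit` — for any admissible `C` (`2 ≤ C m` for `m ≥ 1`) with `TwoCoreBound C`,
  the `2`-adic engine text for integer generators `≡ 1 (mod 8)` (cube-Kummer, multiplicatively independent) with the
  constant `3·C m` (the body of `engineTwoW80_of_coreBound`, unchanged);
* `TwoSetup.engineTwoW80_explicit` — the engine with `3·(2·Cw m) = 6(2⁶⁹m)^m` in the statement.

No new definition; [folklore] bookkeeping on landed theorems.  WHAT THIS IS NOT: no new estimate — the analytic core is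
`twoCoreBound_holds`, used by name. [cite: Yu1990, Theorem 2.1] [cite: Waldschmidt1980, §3.6 (p. 275)]
-/

noncomputable section

open NormedSpace Finset IsUltrametricDist Height
open Literature.NumberTheory.Transcendental
open Literature.NumberTheory.Transcendental.PadicCW77 (reidxEquiv reidxEquiv_castSucc reidxEquiv_last
  snoc_comp_succAbove one_div_le_norm_intCast)
open scoped Nat

namespace Summit.ABC.StewartYu

namespace TwoSetup

/-- **The W80-shape engine at `p = 2` from the core bound, constant in the statement**: for an admissible `C`
(`2 ≤ C m` for `m ≥ 1`) with `TwoCoreBound C`, for integers `αⱼ ≡ 1 (mod 8)` (multiplicatively independent,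
cube-Kummer), heights `h(αⱼ) ≤ Vⱼ`, floors `1 ≤ Vⱼ ≤ Vmax`, `b ≠ 0`, `log max(3,|bⱼ|) ≤ W`, `1 ≤ W`:
`ord₂(∏ αⱼ^{bⱼ} − 1) ≤ 3C(m) · ∏ Vⱼ · (W + log 2Vmax) · log(2Vmax)` — the body of `engineTwoW80_of_coreBound`
verbatim, without the `∃ (C) (c₁)` packaging. [cite: Yu1990, Theorem 2.1] [cite: Waldschmidt1980, §3.6 (p. 275)] -/
theorem engineTwoW80_of_coreBound_explicit {C : ℕ → ℝ} (hC2 : ∀ m, 1 ≤ m → 2 ≤ C m) (hcore : TwoCoreBound C) :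
    ∀ (m : ℕ) (α : Fin m → ℚ) (b : Fin m → ℤ) (V : Fin m → ℝ) (Vmax W : ℝ),
      (∀ j, 3 ≤ padicValRat 2 (α j - 1)) →
      (∀ j, ∃ a : ℤ, α j = a) →
      (∀ μ : Fin m → ℤ, ∏ j, α j ^ μ j = 1 → μ = 0) →
      (∀ κ : Fin m → ℕ, (∃ j, ¬ 3 ∣ κ j) → ∀ γ : ℚ, ∏ j, α j ^ κ j ≠ γ ^ 3) →
      (∀ j, Height.logHeight₁ (α j) ≤ V j) → (∀ j, 1 ≤ V j) → (∀ j, V j ≤ Vmax) →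
      b ≠ 0 → (∀ j, Real.log (max 3 (|b j| : ℝ)) ≤ W) → 1 ≤ W →
      (padicValRat 2 (∏ j, α j ^ b j - 1) : ℝ) ≤
        3 * C m * (∏ j, V j) * (W + Real.log (2 * Vmax)) * Real.log (2 * Vmax) := by
  classical
  intro m α b V Vmax W hα8 hint hmult hK hV hV1 hVmax hb hW hW1
  haveI : Fact (Nat.Prime 2) := ⟨Nat.prime_two⟩
  -- `m = d + 1`
  obtain ⟨d, rfl⟩ : ∃ d, m = d + 1 := by
    rcases m with - | d
    · exact absurd (Subsingleton.elim b 0) hb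
    · exact ⟨d, rfl⟩
  -- positivity bookkeeping for the right-hand side
  have hVpos : ∀ i, 0 < V i := fun i => lt_of_lt_of_le one_pos (hV1 i)
  have hprod1 : 1 ≤ ∏ i, V i := by
    calc (1 : ℝ) = ∏ _i : Fin (d + 1), (1 : ℝ) := by simp
      _ ≤ ∏ i, V i := prod_le_prod (fun _ _ => zero_le_one) fun i _ => hV1 i
  obtain ⟨j₀⟩ : Nonempty (Fin (d + 1)) := ⟨0⟩
  have hVmax1 : 1 ≤ Vmax := (hV1 j₀).trans (hVmax j₀)
  have hlog2 := Real.log_two_gt_d9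
  have hl2V : Real.log 2 ≤ Real.log (2 * Vmax) := Real.log_le_log two_pos (by linarith)
  have hl2V0 : 0 < Real.log (2 * Vmax) := by linarith
  have hW0 : 0 < W := by linarith
  have hC0 : 0 ≤ C (d + 1) := by linarith [hC2 (d + 1) d.succ_pos]
  have hRHS0 : 0 ≤ 3 * C (d + 1) * (∏ j, V j) * (W + Real.log (2 * Vmax)) * Real.log (2 * Vmax) := by
    have : 0 ≤ W + Real.log (2 * Vmax) := by linarith
    positivity
  -- the trivial case `ord₂(Θ₀ − 1) ≤ 0`
  set Θ₀ : ℚ := ∏ j, α j ^ b j with hΘ₀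
  by_cases hv : padicValRat 2 (Θ₀ - 1) < 1
  · have : (padicValRat 2 (Θ₀ - 1) : ℝ) ≤ 0 := by
      exact_mod_cast (show padicValRat 2 (Θ₀ - 1) ≤ 0 by omega)
    exact this.trans hRHS0
  push Not at hv
  have hΘ₀1 : Θ₀ - 1 ≠ 0 := by
    intro h0; rw [h0, padicValRat.zero] at hv; exact absurd hv (by norm_num)
  have hnormΘ : ‖((Θ₀ - 1 : ℚ) : ℚ_[2])‖ = ((2 : ℕ) : ℝ) ^ (-padicValRat 2 (Θ₀ - 1)) := by
    rw [Padic.norm_eq_zpow_neg_valuation (by exact_mod_cast hΘ₀1), Padic.valuation_ratCast]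
  -- an index with `b ≠ 0` of minimal `2`-adic order
  set I : Finset (Fin (d + 1)) := univ.filter fun i => b i ≠ 0 with hI
  have hIne : I.Nonempty := by
    by_contra hne
    rw [Finset.not_nonempty_iff_eq_empty] at hne
    apply hb; funext i
    by_contra hbi
    have : i ∈ I := by rw [hI, mem_filter]; exact ⟨mem_univ _, hbi⟩
    rw [hne] at this; simp at this
  obtain ⟨i₀, hi₀I, hmin⟩ := I.exists_min_image (fun i => padicValInt 2 (b i)) hIne
  have hbi₀ : b i₀ ≠ 0 := by rw [hI, mem_filter] at hi₀I; exact hi₀I.2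
  -- the set-up
  let S : TwoSetup :=
    { d := d, α := fun j => α (i₀.succAbove j), θ := α i₀,
      b := fun j => b (i₀.succAbove j), bθ := b i₀, bθ_ne := hbi₀,
      hbmin := fun j hj => hmin _ (by rw [hI, mem_filter]; exact ⟨mem_univ _, hj⟩),
      hα := fun j => hα8 _, hθ := hα8 i₀ }
  -- `S.toQ.all = α ∘ e`
  have hall : ∀ i, S.toQ.all i = α (reidxEquiv i₀ i) := fun i => snoc_comp_succAbove α i₀ i
  -- transport the integrality
  have hint' : ∀ i, ∃ a : ℤ, S.toQ.all i = a := fun i => by rw [hall]; exact hint _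
  -- transport the cube-Kummer condition
  have hK' : ∀ κ : Fin (S.d + 1) → ℕ, (∃ j, ¬ 3 ∣ κ j) → ∀ γ : ℚ, ∏ i, S.toQ.all i ^ κ i ≠ γ ^ 3 := by
    intro κ hκ γ hγ
    obtain ⟨j, hj⟩ := hκ
    have e1 : ∏ i, S.toQ.all i ^ κ i = ∏ j, α j ^ κ ((reidxEquiv i₀).symm j) := by
      rw [← (reidxEquiv i₀).prod_comp (fun j => α j ^ κ ((reidxEquiv i₀).symm j))]
      exact prod_congr rfl fun i _ => by rw [hall, Equiv.symm_apply_apply]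
    rw [e1] at hγ
    exact hK (fun j => κ ((reidxEquiv i₀).symm j)) ⟨reidxEquiv i₀ j, by simpa using hj⟩ γ hγ
  -- transport the multiplicative independence
  have hmult' : ∀ μ : Fin (S.d + 1) → ℤ, ∏ i, S.toQ.all i ^ μ i = 1 → μ = 0 := by
    intro μ hμ
    have e1 : ∏ i, S.toQ.all i ^ μ i = ∏ j, α j ^ μ ((reidxEquiv i₀).symm j) := by
      rw [← (reidxEquiv i₀).prod_comp (fun j => α j ^ μ ((reidxEquiv i₀).symm j))]
      exact prod_congr rfl fun i _ => by rw [hall, Equiv.symm_apply_apply]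
    rw [e1] at hμ
    have h0 := hmult _ hμ
    funext i
    have := congrFun h0 (reidxEquiv i₀ i)
    simpa using this
  -- the core bound
  have hΛ₀ := hcore S (fun j => V (i₀.succAbove j)) (V i₀) Vmax W hint' hK' hmult'
    (fun j => hV _) (hV i₀) (fun j => hV1 _) (hV1 i₀) (fun j => hVmax _) (hVmax i₀)
    (fun j => hW _) (hW i₀) hW1
  -- `(∏ⱼ V(succAbove j)) · V i₀ = ∏ᵢ Vᵢ`
  have hprodV : (∏ j : Fin d, V (i₀.succAbove j)) * V i₀ = ∏ i, V i := by
    rw [Fin.prod_univ_succAbove (fun i => V i) i₀, mul_comm]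
  set U : ℝ := C (d + 1) * (∏ i, V i) * (W + Real.log (2 * Vmax)) * Real.log (2 * Vmax) with hU
  have hΛ₀' : Real.exp (-U) < ‖S.Λ₀‖ := by
    have : C (S.d + 1) * ((∏ j : Fin S.d, V (i₀.succAbove j)) * V i₀) *
        (W + Real.log (2 * Vmax)) * Real.log (2 * Vmax) = U := by
      rw [hU]
      change C (d + 1) * ((∏ j : Fin d, V (i₀.succAbove j)) * V i₀) * _ * _ = _
      rw [hprodV]
    rw [this] at hΛ₀; exact hΛ₀
  have hU0 : 0 ≤ U := by
    rw [hU]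
    have : 0 ≤ W + Real.log (2 * Vmax) := by linarith
    positivity
  -- `W ≤ U`
  have hWU : W ≤ U := by
    rw [hU]
    have hC2' := hC2 (d + 1) d.succ_pos
    have h1 : W ≤ C (d + 1) * (W + Real.log (2 * Vmax)) * Real.log (2 * Vmax) := by
      calc W = 2 * W * (1 / 2) := by ring
        _ ≤ C (d + 1) * (W + Real.log (2 * Vmax)) * Real.log (2 * Vmax) := by
            refine mul_le_mul (mul_le_mul hC2' (by linarith) hW0.le (by linarith)) (by linarith)
              (by norm_num) (by positivity)
    calc W ≤ C (d + 1) * (W + Real.log (2 * Vmax)) * Real.log (2 * Vmax) := h1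
      _ = C (d + 1) * 1 * (W + Real.log (2 * Vmax)) * Real.log (2 * Vmax) := by ring
      _ ≤ C (d + 1) * (∏ i, V i) * (W + Real.log (2 * Vmax)) * Real.log (2 * Vmax) := by
          have : 0 ≤ W + Real.log (2 * Vmax) := by linarith
          gcongr
  -- `S.Θ = Θ₀`
  have hΘ : S.Θ = Θ₀ := by
    change (∏ j : Fin d, α (i₀.succAbove j) ^ b (i₀.succAbove j)) * α i₀ ^ b i₀ = _
    rw [hΘ₀, Fin.prod_univ_succAbove (fun i => α i ^ b i) i₀, mul_comm]
  -- `‖Θ₀ − 1‖₂ = ‖Λ‖ = ‖b_θ‖ ‖Λ₀‖ > e^{−W} e^{−U}`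
  have hnorm' : ‖((Θ₀ - 1 : ℚ) : ℚ_[2])‖ = ‖(S.bθ : ℚ_[2])‖ * ‖S.Λ₀‖ := by
    rw [← S.norm_Λ_eq_mul, S.norm_Λ, hΘ]; push_cast; rfl
  have hbθ : Real.exp (-W) ≤ ‖(S.bθ : ℚ_[2])‖ := by
    change Real.exp (-W) ≤ ‖((b i₀ : ℤ) : ℚ_[2])‖
    have habs0 : 0 < |(b i₀ : ℝ)| := abs_pos.mpr (by exact_mod_cast hbi₀)
    have h1 : (1 : ℝ) / |(b i₀ : ℝ)| ≤ ‖((b i₀ : ℤ) : ℚ_[2])‖ := one_div_le_norm_intCast hbi₀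
    have hle : |(b i₀ : ℝ)| ≤ Real.exp W := by
      have hlogb : Real.log |(b i₀ : ℝ)| ≤ W :=
        (Real.log_le_log habs0 (le_max_right _ _)).trans (hW i₀)
      calc |(b i₀ : ℝ)| = Real.exp (Real.log |(b i₀ : ℝ)|) := (Real.exp_log habs0).symm
        _ ≤ Real.exp W := Real.exp_le_exp.mpr hlogb
    calc Real.exp (-W) = 1 / Real.exp W := by rw [Real.exp_neg, one_div]
      _ ≤ 1 / |(b i₀ : ℝ)| := one_div_le_one_div_of_le habs0 hle
      _ ≤ ‖((b i₀ : ℤ) : ℚ_[2])‖ := h1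
  have hkey : Real.exp (-(U + W)) < ((2 : ℕ) : ℝ) ^ (-padicValRat 2 (Θ₀ - 1)) := by
    rw [← hnormΘ, hnorm', show -(U + W) = -W + -U by ring, Real.exp_add]
    exact mul_lt_mul' hbθ hΛ₀' (Real.exp_pos _).le (lt_of_lt_of_le (Real.exp_pos _) hbθ)
  -- take logarithms: `v log 2 < U + W ≤ 2U ≤ 3 log 2 · U`
  have hlog := Real.log_lt_log (Real.exp_pos _) hkey
  rw [Real.log_exp, Real.log_zpow] at hlog
  push_cast at hlog
  have hv2 : (padicValRat 2 (Θ₀ - 1) : ℝ) * Real.log 2 ≤ 2 * U := by nlinarith [hlog, hWU]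
  have h2U : 2 * U ≤ Real.log 2 * (3 * U) := by nlinarith [hlog2, hU0]
  have hfin : (padicValRat 2 (Θ₀ - 1) : ℝ) * Real.log 2 ≤ (3 * U) * Real.log 2 := by
    rw [mul_comm (3 * U)]; exact hv2.trans h2U
  have hv3 := le_of_mul_le_mul_right hfin (by linarith)
  calc (padicValRat 2 (Θ₀ - 1) : ℝ) ≤ 3 * U := hv3
    _ = 3 * C (d + 1) * (∏ j, V j) * (W + Real.log (2 * Vmax)) * Real.log (2 * Vmax) := by
        rw [hU]; ring

/-- **THE `2`-ADIC ENGINE with its constant written out**: `3·(2·Cw(m)) = 6(2⁶⁹m)^m` in the statement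
(`engineTwoW80` is its `∃ (C) (c₁)`-packaging with `c₁ = 3·2^70`). [cite: Yu1990, Theorem 2.1 and §1.1]
[cite: Waldschmidt1980, Prop. 3.8] -/
theorem engineTwoW80_explicit :
    ∀ (m : ℕ) (α : Fin m → ℚ) (b : Fin m → ℤ) (V : Fin m → ℝ) (Vmax W : ℝ),
      (∀ j, 3 ≤ padicValRat 2 (α j - 1)) →
      (∀ j, ∃ a : ℤ, α j = a) →
      (∀ μ : Fin m → ℤ, ∏ j, α j ^ μ j = 1 → μ = 0) →
      (∀ κ : Fin m → ℕ, (∃ j, ¬ 3 ∣ κ j) → ∀ γ : ℚ, ∏ j, α j ^ κ j ≠ γ ^ 3) →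
      (∀ j, Height.logHeight₁ (α j) ≤ V j) → (∀ j, 1 ≤ V j) → (∀ j, V j ≤ Vmax) →
      b ≠ 0 → (∀ j, Real.log (max 3 (|b j| : ℝ)) ≤ W) → 1 ≤ W →
      (padicValRat 2 (∏ j, α j ^ b j - 1) : ℝ) ≤
        3 * (2 * PadicW80Par.Cw m) * (∏ j, V j) * (W + Real.log (2 * Vmax)) * Real.log (2 * Vmax) :=
  engineTwoW80_of_coreBound_explicit (C := fun m => 2 * PadicW80Par.Cw m)
    (fun m hm => by have := PadicW80Par.two_le_Cw hm; change 2 ≤ 2 * PadicW80Par.Cw m; linarith)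
    twoCoreBound_holds

end TwoSetup

end Summit.ABC.StewartYu

end
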